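import Mathlib
import HarnessLib
import Summits.HubbardSuperconductivity.HubbardSuperconductivity.Theorems.KLProgrammeKLRegimeEngineTwoLegStepV17FDoor
import Summits.HubbardSuperconductivity.HubbardSuperconductivity.Theorems.KLProgrammeKLRegimeEngineV8DefsU4
import Summits.HubbardSuperconductivity.HubbardSuperconductivity.Theorems.KLProgrammeKLRegimeSplitTwoLegThresholdsExplicit

/-!
# K3 gen 7-flow: the two-leg doors of stubs (e)/(M) UNDER THE ENGINE-FLOW STUB BINDERS (plan g16 (R28) S4(a) map (m1)/(m2); template
# `planner-g16/KLProgrammeKLRegimeEngineV8SkeletonV17F.template.lean` da2b25c6ea58fb68)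

Cell gate-hubbard-kl, seat hubbard-kl-r2d-p1 (g5).  Sequel of `…EngineTwoLegStepV17FDoor`: `TwoLegStepV17F L M G P Q R β U μ n` at ANY package `(G, Q)` and ANY
`n ≤ nScales β + 1` from (A) the cumulative-reading jets at natural tables + the PLAIN package inequalities, (B) the slopes data at the flow frame, (C) the two
nested-leg rates, in two threshold currencies:

* `twoLegStepV17F_of_jets_sepTubeGradient_nestedLegs` — `c ≤ klCurveC3 R`, `U ≤ klCurveU0 R` (the CT lineage's curve thresholds);
* `twoLegStepV17F_of_jets_sepTubeGradient_nestedLegs_pkg` — the stub binders' `c ≤ klEngC₃3 P R`, `U ≤ klEngU₀4 P R c` (a raised `klEngU₀6 ≤ klEngU₀4`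
  composes by `le_trans`);
* `twoLegStepV17F_zero_of_jets_sepTubeGradient_nestedLegs` — the (M) shape at `n = 0` with `K₀ = 0` displayed literally (`klFlowFrameU … 0 = 0` is `rfl`);
* `le_of_le_div_of_one_le` — converts k3c2-p2's DIVIDED package inequalities `c ≤ S/klJetX` (…DefsG6Q6) to the plain ones the F door reads.

Unused stub binders (`P.WF`, `klEngM₃ … ≤ M`, `IsKLRegime`, the history, the engine bounds) are simply not taken.  Proofs only; nothing about the model is
asserted; nothing asserts superconductivity.  Residual table: HOME/hubbard-kl-r2d-p1/RESIDUAL-TABLE-e-V17F.md.  [cite: BenfattoGiulianiMastropietro2006]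
-/

noncomputable section

namespace Summit.HubbardSuperconductivity.HubbardSuperconductivity.Theorems.EngineV8

set_option linter.dupNamespace false -- summit = problem name (single-conjunct summit), D-0017

open Real Finset Literature.MathematicalPhysics.QuantumLattice Literature.Probability.LatticeModels
open Literature.MathematicalPhysics.QuantumLattice.FermiRG Literature.MathematicalPhysics.QuantumLattice.BandSectorCounting
open Summit.HubbardSuperconductivity.HubbardSuperconductivity.Theorems.KLProgrammeLegKernels
open Summit.HubbardSuperconductivity.HubbardSuperconductivity.Theorems.DispersionFlow
open Summit.HubbardSuperconductivity.HubbardSuperconductivity.Theorems.PerturbedFermiCurve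
open Summit.HubbardSuperconductivity.HubbardSuperconductivity.Theorems.KLRegimeSplit

/-! ## §6 THE DOOR under the engine-flow stub binders (plan g16 (R28) S4(a) map (m1)/(m2)): ANY package `(G, Q)`, ANY scale `n ≤ nScales β + 1`,
thresholds in the CT-lineage currency (`klCurveC3 R`, `klCurveU0 R`) and in the engine currency (`klEngC₃3 P R`, `klEngU₀4 P R c`) -/

section Door

/-- From a DIVIDED package inequality `c ≤ s / x` with `1 ≤ x`, `0 ≤ s` to the plain one `c ≤ s` (k3c2-p2's `le_klEngGeo6_S_div_klJetX` /
`le_klEngQ6_S'_div_klJetX` feed the F door, which needs no `klJetX` division). -/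
theorem le_of_le_div_of_one_le {c s x : ℝ} (h : c ≤ s / x) (hx : 1 ≤ x) (hs : 0 ≤ s) : c ≤ s :=
  h.trans (div_le_self hs hx)

/-- **THE V17F TWO-LEG DOOR, curve-threshold currency** — under `c ≤ klCurveC3 R`, `U ≤ klCurveU0 R`, `klEngL₃ β U ≤ L`, `n ≤ nScales β + 1` and
`FrameOK R U (nScales β) μ K_n`: `TwoLegStepV17F L M G P Q R β U μ n` from
(A) the `C⁴` clause + order-`≤ 4` angular jets of the cumulative reading at tables `cN, cN'` with `cN ≤ G.S`, `cN' ≤ Q.S'`;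
(B) the field strength on the shell + the shell-tube gradient `m₁'` of the `K_n`-separated reading with p1b's fit;
(C) the two nested-leg rates (quarter budget) and the sign `0 ≤ Q.CL β n`. -/
theorem twoLegStepV17F_of_jets_sepTubeGradient_nestedLegs (G : GeoConsts) (Q : EngConsts) {P : SplitConsts} {R : RenConsts}
    (hR : ∀ j, 0 ≤ R.Gfr j) {c : ℝ} (hc : 0 < c) (hcle : c ≤ klCurveC3 R) {μ : ℝ} (hμ : μ ∈ klWindowC) {U : ℝ} (hU : 0 < U)
    (hUle : U ≤ klCurveU0 R) {β : ℝ} (hβ : klBetaMin ≤ β) (hβc : β ≤ Real.exp (c / U ^ 2)) {L M : ℕ} [NeZero L] [NeZero M]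
    (hL : klEngL₃ β U ≤ L) {n : ℕ} (hn : n ≤ nScales β + 1) (hK : FrameOK R U (nScales β) μ (klFlowFrameU L M β U μ n))
    (hCL : 0 ≤ Q.CL β n)
    -- (A) the cumulative-reading jets at natural tables + the package inequalities
    {cN cN' : ℕ → ℝ} (hpk : ∀ k, cN k ≤ G.S k) (hpk' : ∀ k, cN' k ≤ Q.S' k)
    (hC : ContDiff ℝ 4 (fun θ : ℝ => klLocalPart L M β U μ (klFlowFrameU L M β U μ n) n θ))
    (hjets : ∀ k ≤ 4, ∀ θ : ℝ,
      |iteratedDeriv k (fun θ : ℝ => klLocalPart L M β U μ (klFlowFrameU L M β U μ n) n θ) θ| ≤ curveJetBar cN cN' U k n)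
    -- (B) the slopes data at the flow frame
    (hz : ∀ k ∈ klShell L μ (klFlowFrameU L M β U μ n) n,
      |klFieldStrength L M β U μ (klFlowFrameU L M β U μ n) n k - 1| ≤ R.cz * |U|)
    {m₁' : ℝ}
    (hm₁' : ∀ q : Momentum, |frameLevel μ (klFlowFrameU L M β U μ n) q| ≤ klScale klE0 n →
      ‖fderiv ℝ (evalM (symInterp L (fun p => klLocSelfEnergyRe L M β U μ (klFlowFrameU L M β U μ n) n p -
        (klFlowFrameU L M β U μ n).eval (latticeMomentum L p)))) q‖ ≤ m₁')
    (hfit1 : m₁' + 4 / 3 * R.Gfr 1 * U ^ 2 ≤ R.cz * |U| * (cDtmin (-1.2) (-0.05) / 2))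
    -- (C) the two nested-leg rates at scale `n` (each volume at its own flow frame)
    (hcut : ∀ (Mq : ℕ → ℕ) (L₁ M₁ M₂ : ℕ) [NeZero L₁] [NeZero M₁] [NeZero M₂], L ≤ L₁ → Q.M0 β L₁ ≤ M₁ → Mq L₁ ≤ M₁ → M₁ ≤ M₂ →
      (∀ j < n, histV17F L₁ M₁ G P Q R β U μ j ∧ TwoLegSlopes L₁ M₁ R β U μ (klFlowFrameU L₁ M₁ β U μ j) j) →
      (∀ j < n, histV17F L₁ M₂ G P Q R β U μ j ∧ TwoLegSlopes L₁ M₂ R β U μ (klFlowFrameU L₁ M₂ β U μ j) j) →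
        ∀ θ : ℝ, |klLocalPart L₁ M₁ β U μ (klFlowFrameU L₁ M₁ β U μ n) n θ -
          klLocalPart L₁ M₂ β U μ (klFlowFrameU L₁ M₂ β U μ n) n θ| ≤ Q.CL β n / 4 / L₁)
    (hsp : ∀ (Mq : ℕ → ℕ) (L₁ L₂ M₂ : ℕ) [NeZero L₁] [NeZero L₂] [NeZero M₂], L ≤ L₁ → L₁ ∣ L₂ → Q.M0 β L₁ ≤ M₂ → Mq L₁ ≤ M₂ →
      Q.M0 β L₂ ≤ M₂ → Mq L₂ ≤ M₂ →
      (∀ j < n, histV17F L₁ M₂ G P Q R β U μ j ∧ TwoLegSlopes L₁ M₂ R β U μ (klFlowFrameU L₁ M₂ β U μ j) j) →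
      (∀ j < n, histV17F L₂ M₂ G P Q R β U μ j ∧ TwoLegSlopes L₂ M₂ R β U μ (klFlowFrameU L₂ M₂ β U μ j) j) →
        ∀ θ : ℝ, |klLocalPart L₁ M₂ β U μ (klFlowFrameU L₁ M₂ β U μ n) n θ -
          klLocalPart L₂ M₂ β U μ (klFlowFrameU L₂ M₂ β U μ n) n θ| ≤ Q.CL β n / 4 / L₁) :
    TwoLegStepV17F L M G P Q R β U μ n :=
  twoLegStepV17F_of_jets_slopes_nestedLegs (twoLegReadJetsF_of_jets G Q hpk hpk' hC hjets)
    (twoLegSlopes_flowFrame_of_sepTubeGradient hR hc hcle hU hUle hβ hβc hμ hn hK hL hz hm₁' hfit1) hCL hcut hsp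

/-- **THE V17F TWO-LEG DOOR, engine-threshold currency** (the stub binders' `c ≤ klEngC₃3 P R`, `U ≤ klEngU₀4 P R c`, `R.WF2`; a raised package's
`U ≤ klEngU₀6 P R c ≤ klEngU₀4 P R c` composes with `le_trans`): as `twoLegStepV17F_of_jets_sepTubeGradient_nestedLegs`. -/
theorem twoLegStepV17F_of_jets_sepTubeGradient_nestedLegs_pkg (G : GeoConsts) (Q : EngConsts) (P : SplitConsts) (R : RenConsts) (c : ℝ)
    (hR : R.WF2) (hc : 0 < c) (hc3 : c ≤ klEngC₃3 P R) (μ : ℝ) (hμ : μ ∈ klWindowC) (U : ℝ) (hU : 0 < U) (hUle : U ≤ klEngU₀4 P R c)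
    (β : ℝ) (hβ : klBetaMin ≤ β) (hβc : β ≤ Real.exp (c / U ^ 2)) (L M : ℕ) [NeZero L] [NeZero M] (hL : klEngL₃ β U ≤ L)
    (n : ℕ) (hn : n ≤ nScales β + 1) (hK : FrameOK R U (nScales β) μ (klFlowFrameU L M β U μ n)) (hCL : 0 ≤ Q.CL β n)
    -- (A)
    {cN cN' : ℕ → ℝ} (hpk : ∀ k, cN k ≤ G.S k) (hpk' : ∀ k, cN' k ≤ Q.S' k)
    (hC : ContDiff ℝ 4 (fun θ : ℝ => klLocalPart L M β U μ (klFlowFrameU L M β U μ n) n θ))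
    (hjets : ∀ k ≤ 4, ∀ θ : ℝ,
      |iteratedDeriv k (fun θ : ℝ => klLocalPart L M β U μ (klFlowFrameU L M β U μ n) n θ) θ| ≤ curveJetBar cN cN' U k n)
    -- (B)
    (hz : ∀ k ∈ klShell L μ (klFlowFrameU L M β U μ n) n,
      |klFieldStrength L M β U μ (klFlowFrameU L M β U μ n) n k - 1| ≤ R.cz * |U|)
    {m₁' : ℝ}
    (hm₁' : ∀ q : Momentum, |frameLevel μ (klFlowFrameU L M β U μ n) q| ≤ klScale klE0 n →
      ‖fderiv ℝ (evalM (symInterp L (fun p => klLocSelfEnergyRe L M β U μ (klFlowFrameU L M β U μ n) n p -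
        (klFlowFrameU L M β U μ n).eval (latticeMomentum L p)))) q‖ ≤ m₁')
    (hfit1 : m₁' + 4 / 3 * R.Gfr 1 * U ^ 2 ≤ R.cz * |U| * (cDtmin (-1.2) (-0.05) / 2))
    -- (C)
    (hcut : ∀ (Mq : ℕ → ℕ) (L₁ M₁ M₂ : ℕ) [NeZero L₁] [NeZero M₁] [NeZero M₂], L ≤ L₁ → Q.M0 β L₁ ≤ M₁ → Mq L₁ ≤ M₁ → M₁ ≤ M₂ →
      (∀ j < n, histV17F L₁ M₁ G P Q R β U μ j ∧ TwoLegSlopes L₁ M₁ R β U μ (klFlowFrameU L₁ M₁ β U μ j) j) →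
      (∀ j < n, histV17F L₁ M₂ G P Q R β U μ j ∧ TwoLegSlopes L₁ M₂ R β U μ (klFlowFrameU L₁ M₂ β U μ j) j) →
        ∀ θ : ℝ, |klLocalPart L₁ M₁ β U μ (klFlowFrameU L₁ M₁ β U μ n) n θ -
          klLocalPart L₁ M₂ β U μ (klFlowFrameU L₁ M₂ β U μ n) n θ| ≤ Q.CL β n / 4 / L₁)
    (hsp : ∀ (Mq : ℕ → ℕ) (L₁ L₂ M₂ : ℕ) [NeZero L₁] [NeZero L₂] [NeZero M₂], L ≤ L₁ → L₁ ∣ L₂ → Q.M0 β L₁ ≤ M₂ → Mq L₁ ≤ M₂ →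
      Q.M0 β L₂ ≤ M₂ → Mq L₂ ≤ M₂ →
      (∀ j < n, histV17F L₁ M₂ G P Q R β U μ j ∧ TwoLegSlopes L₁ M₂ R β U μ (klFlowFrameU L₁ M₂ β U μ j) j) →
      (∀ j < n, histV17F L₂ M₂ G P Q R β U μ j ∧ TwoLegSlopes L₂ M₂ R β U μ (klFlowFrameU L₂ M₂ β U μ j) j) →
        ∀ θ : ℝ, |klLocalPart L₁ M₂ β U μ (klFlowFrameU L₁ M₂ β U μ n) n θ -
          klLocalPart L₂ M₂ β U μ (klFlowFrameU L₂ M₂ β U μ n) n θ| ≤ Q.CL β n / 4 / L₁) :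
    TwoLegStepV17F L M G P Q R β U μ n :=
  have hR' : ∀ j, 0 ≤ R.Gfr j := hR.1.2.2
  twoLegStepV17F_of_jets_sepTubeGradient_nestedLegs G Q hR' hc (hc3.trans (klEngC₃3_le_klCurveC3 P hR')) hμ hU
    ((le_klEngU₀3_of_le_klEngU₀4 hUle).trans (klEngU₀3_le_klCurveU0 P hR' c)) hβ hβc hL hn hK hCL hpk hpk' hC hjets hz hm₁' hfit1 hcut hsp


/-- **THE V17F TWO-LEG DOOR AT SCALE `0` (the (M) shape), bare frame `K₀ = 0` written literally** (`klFlowFrameU … 0 = 0` is `rfl`): as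
`twoLegStepV17F_of_jets_sepTubeGradient_nestedLegs` with every flow frame at scale `0` displayed as `0` and the (vacuous) histories kept for shape. -/
theorem twoLegStepV17F_zero_of_jets_sepTubeGradient_nestedLegs (G : GeoConsts) (Q : EngConsts) {P : SplitConsts} {R : RenConsts}
    (hR : ∀ j, 0 ≤ R.Gfr j) {c : ℝ} (hc : 0 < c) (hcle : c ≤ klCurveC3 R) {μ : ℝ} (hμ : μ ∈ klWindowC) {U : ℝ} (hU : 0 < U)
    (hUle : U ≤ klCurveU0 R) {β : ℝ} (hβ : klBetaMin ≤ β) (hβc : β ≤ Real.exp (c / U ^ 2)) {L M : ℕ} [NeZero L] [NeZero M]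
    (hL : klEngL₃ β U ≤ L) (hK : FrameOK R U (nScales β) μ 0) (hCL : 0 ≤ Q.CL β 0)
    -- (A) the scale-0 reading jets at natural tables + the package inequalities
    {cN cN' : ℕ → ℝ} (hpk : ∀ k, cN k ≤ G.S k) (hpk' : ∀ k, cN' k ≤ Q.S' k)
    (hC : ContDiff ℝ 4 (fun θ : ℝ => klLocalPart L M β U μ 0 0 θ))
    (hjets : ∀ k ≤ 4, ∀ θ : ℝ, |iteratedDeriv k (fun θ : ℝ => klLocalPart L M β U μ 0 0 θ) θ| ≤ curveJetBar cN cN' U k 0)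
    -- (B) the slopes data at the bare frame
    (hz : ∀ k ∈ klShell L μ 0 0, |klFieldStrength L M β U μ 0 0 k - 1| ≤ R.cz * |U|)
    {m₁' : ℝ}
    (hm₁' : ∀ q : Momentum, |frameLevel μ 0 q| ≤ klScale klE0 0 →
      ‖fderiv ℝ (evalM (symInterp L (fun p => klLocSelfEnergyRe L M β U μ 0 0 p - (0 : TrigPolyC4v).eval (latticeMomentum L p)))) q‖ ≤ m₁')
    (hfit1 : m₁' + 4 / 3 * R.Gfr 1 * U ^ 2 ≤ R.cz * |U| * (cDtmin (-1.2) (-0.05) / 2))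
    -- (C) the two nested-leg rates at scale `0` (vacuous histories kept for shape)
    (hcut : ∀ (Mq : ℕ → ℕ) (L₁ M₁ M₂ : ℕ) [NeZero L₁] [NeZero M₁] [NeZero M₂], L ≤ L₁ → Q.M0 β L₁ ≤ M₁ → Mq L₁ ≤ M₁ → M₁ ≤ M₂ →
      (∀ j < 0, histV17F L₁ M₁ G P Q R β U μ j ∧ TwoLegSlopes L₁ M₁ R β U μ (klFlowFrameU L₁ M₁ β U μ j) j) →
      (∀ j < 0, histV17F L₁ M₂ G P Q R β U μ j ∧ TwoLegSlopes L₁ M₂ R β U μ (klFlowFrameU L₁ M₂ β U μ j) j) →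
        ∀ θ : ℝ, |klLocalPart L₁ M₁ β U μ 0 0 θ - klLocalPart L₁ M₂ β U μ 0 0 θ| ≤ Q.CL β 0 / 4 / L₁)
    (hsp : ∀ (Mq : ℕ → ℕ) (L₁ L₂ M₂ : ℕ) [NeZero L₁] [NeZero L₂] [NeZero M₂], L ≤ L₁ → L₁ ∣ L₂ → Q.M0 β L₁ ≤ M₂ → Mq L₁ ≤ M₂ →
      Q.M0 β L₂ ≤ M₂ → Mq L₂ ≤ M₂ →
      (∀ j < 0, histV17F L₁ M₂ G P Q R β U μ j ∧ TwoLegSlopes L₁ M₂ R β U μ (klFlowFrameU L₁ M₂ β U μ j) j) →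
      (∀ j < 0, histV17F L₂ M₂ G P Q R β U μ j ∧ TwoLegSlopes L₂ M₂ R β U μ (klFlowFrameU L₂ M₂ β U μ j) j) →
        ∀ θ : ℝ, |klLocalPart L₁ M₂ β U μ 0 0 θ - klLocalPart L₂ M₂ β U μ 0 0 θ| ≤ Q.CL β 0 / 4 / L₁) :
    TwoLegStepV17F L M G P Q R β U μ 0 :=
  twoLegStepV17F_of_jets_sepTubeGradient_nestedLegs G Q hR hc hcle hμ hU hUle hβ hβc hL (Nat.zero_le _) hK hCL hpk hpk' hC hjets hz
    hm₁' hfit1 hcut hsp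

end Door

end Summit.HubbardSuperconductivity.HubbardSuperconductivity.Theorems.EngineV8

end
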